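import Summits.Parity.GeneralizedHardyLittlewood.Theorems.ChenParityOracleBLAPHostParityFromBrickTypeIBDHBlocks
import HarnessLib

/-!
# Route `ChenParityOracleBLAP` — crux S1 = `HostParityFromBrick` (stmt-Parity-20045): Barban–Davenport–Halberstam for `λ` on initial segments — one large block

Support file for the prime half `K1 → K2 → HP1` of S1 (the unconditional Type-I input, large
moduli).  From BFI's Theorem 0 (`BombieriFriedlanderIwaniecTheorem0a_classic`, the large sieve form
of the Barban–Davenport–Halberstam theorem for sequences with (A₂)) and (A₂) for `λ`
(`siegelWalfiszHyp_liouville`), the mean square of the Liouville function in reduced classes over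
INITIAL SEGMENTS:
`∑_{q ≤ Q} ∑_{(l,q)=1} |∑_{v ≤ V, v ≡ l (q)} λ(v)|² ≤ C X²/(log X)^A` for `X ≥ X₀`, `Q ≤ X^{3/4}`,
`V ≤ X` (`bdh_liouville_initial`): `[1, V]` is a union of `≤ 2 log X` dyadic blocks; blocks above
`X^{7/8}` by Theorem 0 plus the coprime mean `∑_{n ∼ N, (n,q)=1} λ(n)` (Möbius and the prime number
theorem for `λ`, i.e. Siegel–Walfisz with `q = 1`), blocks below `X^{7/8}` trivially.

References: E. Bombieri, J. B. Friedlander, H. Iwaniec, Acta Math. 156 (1986), Theorem 0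
[BombieriFriedlanderIwaniecActa1986]; H. L. Montgomery, R. C. Vaughan, *Multiplicative Number
Theory I* (2007), §17 [MontgomeryVaughan2007].
-/

namespace Summit.Parity.GeneralizedHardyLittlewood.Theorems

open Finset Real
open scoped ArithmeticFunction.sigma
open ArithmeticFunction (liouville)
open Literature.NumberTheory.Sieve Literature.NumberTheory.Sieve.BFI

/-! ### One block, with the constants of the theorem -/

/-- **A large block** `N ∈ [X^{7/8}, X]` in the proof of `bdh_liouville_initial`: Theorem 0 for `λ`
(hypothesis `h0`), the coprime means (hypothesis `hCm`) and `∑ τ²/φ ≤ Cτ (log X)^{16}` give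
`∑_{q ≤ Q} ∑_{(l,q)=1} (∑_{n ∼ N, n ≡ l} λ)² ≤ K₁ N²/L^{A+2} + K₂ L^{16} N` with
`K₁ = 6C₀'(8/7)^{A+2} + 4Cm²Cτ(8/7)^{A+18}`, `K₂ = 4Cm²Cτ`, `L = log X`. -/
theorem bdh_block_large {A X N C₀ C₀' Cm Cτ : ℝ} {Q : ℕ} (hA : 0 < A) (hX16 : 16 ≤ X)
    (hE3 : Real.log X ^ (2 * A + 8) ≤ X ^ (1 / 8 : ℝ)) (hQ : (Q : ℝ) ≤ X ^ (3 / 4 : ℝ))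
    (hQX : (Q : ℝ) ≤ X) (hNX : N ≤ X) (hbig : X ^ (7 / 8 : ℝ) ≤ N) (hN9 : 9 ≤ N)
    (hC₀ : C₀ ≤ C₀') (hC₀' : 0 ≤ C₀') (hCm0 : 0 ≤ Cm)
    (h0 : ∀ Q' : ℝ, Q' ≤ N / Real.log N ^ (2 * (A + 2) + 4) →
      ∑ q ∈ Icc 1 ⌊Q'⌋₊, ∑ l ∈ (range q).filter (fun l => l.Coprime q),
        ((∑ n ∈ dyadic N, if (n : ZMod q) = (l : ZMod q) then (liouville n : ℝ) else 0) -
          (∑ n ∈ dyadic N, if n.Coprime q then (liouville n : ℝ) else 0) / (Nat.totient q : ℝ)) ^ 2 ≤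
        C₀ * l2Sq N (fun n => (liouville n : ℝ)) * N / Real.log N ^ (A + 2))
    (hCm : ∀ q : ℕ, 1 ≤ q → |∑ n ∈ (dyadic N).filter (fun n : ℕ => n.Coprime q), (liouville n : ℝ)| ≤
      Cm * (σ 0 q : ℝ) * (N / Real.log N ^ (A / 2 + 9) + Real.sqrt N))
    (hτ : ∑ q ∈ Icc 1 ⌊X⌋₊, (σ 0 q : ℝ) ^ 2 / (Nat.totient q : ℝ) ≤ Cτ * Real.log X ^ (2 ^ (2 + 2))) :
    ∑ q ∈ Icc 1 Q, ∑ l ∈ (range q).filter (fun l => l.Coprime q),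
      (∑ n ∈ dyadic N, if (n : ZMod q) = (l : ZMod q) then (liouville n : ℝ) else 0) ^ 2 ≤
      (6 * C₀' * (8 / 7) ^ (A + 2) + 4 * Cm ^ 2 * Cτ * (8 / 7) ^ (A + 18)) * N ^ 2 / Real.log X ^ (A + 2) +
        (4 * Cm ^ 2 * Cτ) * Real.log X ^ 16 * N := by
  set L := Real.log X with hL
  set B : ℝ := A / 2 + 9 with hBdef
  have hX1 : 1 ≤ X := by linarith
  have hX0 : 0 < X := by linarith
  have hL2 : 2 ≤ L := by
    rw [hL]
    have : Real.exp 2 ≤ X := by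
      have h2 : Real.exp 2 = Real.exp 1 * Real.exp 1 := by rw [← Real.exp_add]; norm_num
      rw [h2]; nlinarith [Real.exp_one_lt_d9, Real.exp_one_gt_d9]
    calc (2 : ℝ) = Real.log (Real.exp 2) := (Real.log_exp 2).symm
      _ ≤ Real.log X := Real.log_le_log (Real.exp_pos 2) this
  have hL1 : 1 ≤ L := by linarith
  have hL0 : 0 < L := by linarith
  have hLpow : ∀ c : ℝ, 0 < L ^ c := fun c => Real.rpow_pos_of_pos hL0 c
  have hN0 : 0 ≤ N := by linarith
  have hN4 : 4 ≤ N := by linarith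
  have hN1 : 1 ≤ N := by linarith
  have hlogN : 7 / 8 * L ≤ Real.log N := by
    have : Real.log (X ^ (7 / 8 : ℝ)) = 7 / 8 * L := by rw [Real.log_rpow hX0]
    rw [← this]; exact Real.log_le_log (by positivity) hbig
  have hlogN0 : 0 < Real.log N := by linarith
  have hlogNL : Real.log N ≤ L := by rw [hL]; exact Real.log_le_log (by linarith) hNX
  -- the level condition of Theorem 0
  have hQN : (Q : ℝ) ≤ N / Real.log N ^ (2 * (A + 2) + 4) := by
    rw [show 2 * (A + 2) + 4 = 2 * A + 8 by ring]
    have h1 : Real.log N ^ (2 * A + 8) ≤ L ^ (2 * A + 8) :=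
      Real.rpow_le_rpow hlogN0.le hlogNL (by linarith)
    have h2 : X ^ (3 / 4 : ℝ) * L ^ (2 * A + 8) ≤ N := by
      calc X ^ (3 / 4 : ℝ) * L ^ (2 * A + 8) ≤ X ^ (3 / 4 : ℝ) * X ^ (1 / 8 : ℝ) :=
            mul_le_mul_of_nonneg_left hE3 (by positivity)
        _ = X ^ (7 / 8 : ℝ) := by rw [← Real.rpow_add hX0]; norm_num
        _ ≤ N := hbig
    rw [le_div_iff₀ (Real.rpow_pos_of_pos hlogN0 _)]
    calc (Q : ℝ) * Real.log N ^ (2 * A + 8) ≤ X ^ (3 / 4 : ℝ) * L ^ (2 * A + 8) :=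
          mul_le_mul hQ h1 (by positivity) (by positivity)
      _ ≤ N := h2
  have h0' := h0 (Q : ℝ) hQN
  rw [Nat.floor_natCast] at h0'
  -- the coprime means
  set W : ℝ := Cm * (N / Real.log N ^ B + Real.sqrt N) with hW
  have hW0 : 0 ≤ W := by positivity
  have hmean : ∀ q ∈ Icc 1 Q, |∑ n ∈ dyadic N, if n.Coprime q then (liouville n : ℝ) else 0| ≤
      W * (σ 0 q : ℝ) := by
    intro q hq
    rw [← Finset.sum_filter]
    have := hCm q (Finset.mem_Icc.mp hq).1
    rw [hW]; linarith [this]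
  have hlarge := sum_sq_dyadic_class_large h0' hmean
  refine hlarge.trans ?_
  -- first term
  have hl2 : l2Sq N (fun n => (liouville n : ℝ)) ≤ 3 * N := by
    have : l2Sq N (fun n => (liouville n : ℝ)) ≤ #(dyadic N) := by
      unfold l2Sq
      calc ∑ n ∈ dyadic N, (liouville n : ℝ) ^ 2 ≤ ∑ _n ∈ dyadic N, (1 : ℝ) :=
            Finset.sum_le_sum fun n _ => by
              rw [← sq_abs]
              have := Literature.NumberTheory.LFunctions.LiouvilleSum.abs_liouville_le_one n
              nlinarith [abs_nonneg (liouville n : ℝ)]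
        _ = #(dyadic N) := by simp
    linarith [card_dyadic_le hN0]
  have hpowA : (7 / 8 * L) ^ (A + 2) ≤ Real.log N ^ (A + 2) :=
    Real.rpow_le_rpow (by positivity) hlogN (by linarith)
  have h78A : (7 / 8 * L) ^ (A + 2) = L ^ (A + 2) / (8 / 7) ^ (A + 2) := by
    rw [Real.mul_rpow (by norm_num) hL0.le, show (7 / 8 : ℝ) = (8 / 7)⁻¹ by norm_num,
      Real.inv_rpow (by norm_num)]; ring
  have e1 : 2 * (C₀ * l2Sq N (fun n => (liouville n : ℝ)) * N / Real.log N ^ (A + 2)) ≤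
      6 * C₀' * (8 / 7) ^ (A + 2) * N ^ 2 / L ^ (A + 2) := by
    have hl0 := l2Sq_nonneg N (fun n => (liouville n : ℝ))
    have hnum : C₀ * l2Sq N (fun n => (liouville n : ℝ)) * N ≤ C₀' * (3 * N) * N := by
      calc C₀ * l2Sq N (fun n => (liouville n : ℝ)) * N ≤ C₀' * l2Sq N _ * N := by gcongr
        _ ≤ C₀' * (3 * N) * N := by gcongr
    have hstep : C₀ * l2Sq N (fun n => (liouville n : ℝ)) * N / Real.log N ^ (A + 2) ≤
        C₀' * (3 * N) * N / (7 / 8 * L) ^ (A + 2) :=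
      (div_le_div_of_nonneg_right hnum (by positivity)).trans
        (div_le_div_of_nonneg_left (by positivity) (by positivity) hpowA)
    calc 2 * (C₀ * l2Sq N (fun n => (liouville n : ℝ)) * N / Real.log N ^ (A + 2))
        ≤ 2 * (C₀' * (3 * N) * N / (7 / 8 * L) ^ (A + 2)) := by linarith
      _ = 6 * C₀' * (8 / 7) ^ (A + 2) * N ^ 2 / L ^ (A + 2) := by
          rw [h78A]; field_simp; ring
  -- second term
  have hSτ : ∑ q ∈ Icc 1 Q, (σ 0 q : ℝ) ^ 2 / (Nat.totient q : ℝ) ≤ Cτ * L ^ 16 := by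
    have h1 : ∑ q ∈ Icc 1 Q, (σ 0 q : ℝ) ^ 2 / (Nat.totient q : ℝ) ≤
        ∑ q ∈ Icc 1 ⌊X⌋₊, (σ 0 q : ℝ) ^ 2 / (Nat.totient q : ℝ) :=
      Finset.sum_le_sum_of_subset_of_nonneg (Finset.Icc_subset_Icc_right (Nat.le_floor hQX))
        fun _ _ _ => by positivity
    have h3 : Real.log X ^ (2 ^ (2 + 2)) = L ^ (16 : ℕ) := by rw [hL]; norm_num
    exact h1.trans (hτ.trans (le_of_eq (by rw [h3])))
  have hWle : W ≤ Cm * ((8 / 7) ^ B * N / L ^ B + Real.sqrt N) := by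
    rw [hW]
    refine mul_le_mul_of_nonneg_left (add_le_add ?_ le_rfl) hCm0
    have hpowB : (7 / 8 * L) ^ B ≤ Real.log N ^ B := Real.rpow_le_rpow (by positivity) hlogN (by positivity)
    calc N / Real.log N ^ B ≤ N / (7 / 8 * L) ^ B := div_le_div_of_nonneg_left hN0 (by positivity) hpowB
      _ = (8 / 7) ^ B * N / L ^ B := by
          rw [Real.mul_rpow (by norm_num) hL0.le, show (7 / 8 : ℝ) = (8 / 7)⁻¹ by norm_num,
            Real.inv_rpow (by norm_num)]; field_simp
  have hW2 : W ^ 2 ≤ 2 * Cm ^ 2 * ((8 / 7) ^ (2 * B) * N ^ 2 / L ^ (2 * B) + N) := by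
    have hpow2 : ((8 / 7 : ℝ) ^ B * N / L ^ B) ^ 2 = (8 / 7) ^ (2 * B) * N ^ 2 / L ^ (2 * B) := by
      rw [div_pow, mul_pow, ← Real.rpow_natCast ((8/7 : ℝ) ^ B) 2, ← Real.rpow_mul (by norm_num),
        ← Real.rpow_natCast (L ^ B) 2, ← Real.rpow_mul hL0.le]
      push_cast; ring_nf
    calc W ^ 2 ≤ (Cm * ((8 / 7) ^ B * N / L ^ B + Real.sqrt N)) ^ 2 := pow_le_pow_left₀ hW0 hWle 2
      _ = Cm ^ 2 * ((8 / 7) ^ B * N / L ^ B + Real.sqrt N) ^ 2 := by ring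
      _ ≤ Cm ^ 2 * (2 * ((8 / 7) ^ B * N / L ^ B) ^ 2 + 2 * Real.sqrt N ^ 2) := by
          gcongr; nlinarith [sq_nonneg ((8 / 7 : ℝ) ^ B * N / L ^ B - Real.sqrt N)]
      _ = 2 * Cm ^ 2 * ((8 / 7) ^ (2 * B) * N ^ 2 / L ^ (2 * B) + N) := by
          rw [Real.sq_sqrt hN0, hpow2]; ring
  have h2B : 2 * B = A + 18 := by rw [hBdef]; ring
  have hL16 : L ^ (16 : ℕ) / L ^ (A + 18) = 1 / L ^ (A + 2) := by
    rw [← Real.rpow_natCast L 16, div_eq_div_iff (hLpow _).ne' (hLpow _).ne', one_mul,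
      ← Real.rpow_add hL0]
    congr 1; push_cast; ring
  have e2 : 2 * W ^ 2 * ∑ q ∈ Icc 1 Q, (σ 0 q : ℝ) ^ 2 / (Nat.totient q : ℝ) ≤
      4 * Cm ^ 2 * Cτ * (8 / 7) ^ (A + 18) * N ^ 2 / L ^ (A + 2) + 4 * Cm ^ 2 * Cτ * L ^ 16 * N := by
    have hS0 : 0 ≤ ∑ q ∈ Icc 1 Q, (σ 0 q : ℝ) ^ 2 / (Nat.totient q : ℝ) :=
      Finset.sum_nonneg fun _ _ => by positivity
    calc 2 * W ^ 2 * ∑ q ∈ Icc 1 Q, (σ 0 q : ℝ) ^ 2 / (Nat.totient q : ℝ)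
        ≤ 2 * (2 * Cm ^ 2 * ((8 / 7) ^ (2 * B) * N ^ 2 / L ^ (2 * B) + N)) * (Cτ * L ^ 16) := by
          gcongr
      _ = 4 * Cm ^ 2 * Cτ * (8 / 7) ^ (A + 18) * N ^ 2 * (L ^ 16 / L ^ (A + 18)) +
            4 * Cm ^ 2 * Cτ * L ^ 16 * N := by rw [h2B]; ring
      _ = _ := by rw [hL16]; ring
  calc _ ≤ 6 * C₀' * (8 / 7) ^ (A + 2) * N ^ 2 / L ^ (A + 2) +
        (4 * Cm ^ 2 * Cτ * (8 / 7) ^ (A + 18) * N ^ 2 / L ^ (A + 2) + 4 * Cm ^ 2 * Cτ * L ^ 16 * N) :=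
        add_le_add e1 e2
    _ = _ := by ring

end Summit.Parity.GeneralizedHardyLittlewood.Theorems
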